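import Summits.SmoothPoincare4.SmoothPoincare4.Theorems.ConvexBisectionAcyclicBisectionExistsBeltMonodromyTransit
import HarnessLib

/-!
# N1 ▸ `node_N1_move` ▸ (d) N1-mono (the deep-belt monodromy model), brick J1-(d5), part 2:
# THE TRANSIT IS A SMOOTH IMMERSION IN FLAT FORM
(wave 8, crux stmt-SmoothPoincare4-10508, line `modp-braid-orbits`, registered stub `stub_M2geo` (N1) ▸
`node_N1_move` ▸ sub-node (d) = H4's `helper_N1_beltMonodromy`; geometric dictionary of piece (d5) of
`work/stubs/H4-REPORT.md` §4, continued from `…BeltMonodromyTransit.lean`; registered sub-goal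
`helper_beltGlue_transitSmooth`)

For the transit `χ̂ p := β♭⁻¹ (∂(G₀⁻¹)⁻¹ (Λ₀ p)) ∈ S¹ × ℝ²` of the seam-lift chart of the input chart family `φ` of (d)
(`…BeltMonodromyTransit.lean`) we prove, at every box point `p` (`|r'| < 1`, `|σ| < η₁`) off the cores whose seam lift is in
the belt region:
* §1 SMOOTH: `χ̂` is `C^∞` at `p` (H4-8's smoothness of `Λ₀`, the diffeomorphism `∂(G₀⁻¹)⁻¹`, the smooth inverse of the
  belt tube on its target), and so are its flat components `(χ̂ ·).2 ∈ ℝ²` and `((χ̂ ·).1 : ℝ²)`;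
* §2 IMMERSION in flat form: for every global section `ang` of `u ↦ e^{2πiu}` smooth at `(χ̂ p).1` (the tree's `angA`,
  `angB`), the FLAT TRANSIT `F p' := (ang (χ̂ p').1, (χ̂ p').2) ∈ ℝ × ℝ²` satisfies `B ∘ F = Λ₀` near `p`, hence has
  injective — so bijective, `3 = 3` — differential at `p` (H4-8: `Λ₀` is an immersion where `φ` is oriented).  Its local
  inverses are the chart-coordinate functions on the belt: the source of the pushed field `W := F_* ∂_σ` of piece (d5′)
  and of the smooth return coordinates of piece (d8).

Everything is proved; no definitions, no named facts, no `sorry`.  References: J. M. Lee, *Introduction to Smooth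
Manifolds* (2012), Thm. 4.25, Thm. 5.11 [LeeSmoothManifolds2013]; A. A. Kosinski, *Differential Manifolds* (1993), VI §6
[Kosinski1993].
-/

noncomputable section

set_option linter.dupNamespace false

open scoped Manifold ContDiff Topology ComplexConjugate
open Set Function Metric Complex Filter
open Literature.Topology.FourManifolds Literature.Topology.FourManifolds.HandleAttachingMap
  Literature.Topology.FourManifolds.LefschetzBase

namespace Summit.SmoothPoincare4.SmoothPoincare4.Theorems.AcyclicBisectionExists.ModpBraidOrbits

/-! ## §1 Smoothness of the transit and of its flat components -/

section Smooth

variable {g n : ℕ} [Nonempty (bBase g).carrier] {h : Fin n → HandleAttachingMap 3 2 (Base g)}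
  {X₀ : Type} [TopologicalSpace X₀] [ChartedSpace (EuclideanHalfSpace 4) X₀]
  (bX : BoundaryData (𝓡∂ 4) X₀ (𝓡 3)) (Ψ : bX.carrier ≃ₘ⟮𝓡 3, 𝓡 3⟯ (bBase g).carrier)
  {X : Type} [TopologicalSpace X] [ChartedSpace (EuclideanHalfSpace 4) X] [IsManifold (𝓡∂ 4) ∞ X]
  [Nonempty (BoundaryManifold.boundaryData 3 X).carrier]
  (G₀ : X₀ ≃ₘ⟮𝓡∂ 4, 𝓡∂ 4⟯ X) (D : MultiAttachmentData h (𝓡∂ 4) X) (d : Fin n → ℂ) (k : Fin n)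

/-- **SMOOTH**: the transit is `C^∞` at every box point (`|σ| < η₁`) off the cores whose seam lift is in the belt
region (H4-8's smoothness of `Λ₀`, the diffeomorphism `T⁻¹`, the smooth inverse of the belt tube on its target).
[cite: LeeSmoothManifolds2013, Thm. 5.11] -/
theorem contMDiffAt_transit (hd : ‖d k‖ = 1) {η₁ : ℝ} {φ : ℝ × ℝ × ℝ → Base g}
    (hφs : ContMDiff 𝓘(ℝ, ℝ × ℝ × ℝ) (𝓡∂ 4) ∞ φ)
    (hφp : ∀ u r σ, σ ∈ Icc (-η₁) η₁ → φ (u, r, σ) ∈ page g (d k * Complex.exp ((σ : ℂ) * Complex.I)))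
    {p : ℝ × ℝ × ℝ} (hσ : p.2.2 ∈ Ioo (-η₁) η₁) (hoff : φ p ∈ coresComplement h)
    (hy : G₀ (bX.incl (seamLiftChart bX Ψ G₀ D φ p)) ∈ range (beltMap D k).toFun) :
    ContMDiffAt 𝓘(ℝ, ℝ × ℝ × ℝ) ((𝓡 1).prod 𝓘(ℝ, EuclideanSpace ℝ (Fin 2))) ∞ (transit bX Ψ G₀ D k φ) p := by
  have hΛ : ContMDiffAt 𝓘(ℝ, ℝ × ℝ × ℝ) (𝓡 3) ∞ (seamLiftChart bX Ψ G₀ D φ) p :=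
    contMDiffAt_seamLiftChart bX Ψ G₀ D hd hφs hφp hσ hoff
  have hT : ContMDiffAt (𝓡 3) (𝓡 3) ∞ ((BoundaryManifold.boundaryData 3 X).restrictDiffeomorph bX G₀.symm).symm
      (seamLiftChart bX Ψ G₀ D φ p) :=
    ((BoundaryManifold.boundaryData 3 X).restrictDiffeomorph bX G₀.symm).symm.contMDiff.contMDiffAt
  have hβ := (beltMap D k).boundaryTube.contMDiffAt_symm (symm_mem_boundaryTube_target bX G₀ D k hy)
  have h1 := hβ.comp (seamLiftChart bX Ψ G₀ D φ p) hT
  have h2 := h1.comp p hΛ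
  exact h2

/-- The fibre component `p ↦ (χ̂ p).2 ∈ ℝ²` of the transit is `C^∞` (manifold form). [folklore] -/
theorem contMDiffAt_transit_snd (hd : ‖d k‖ = 1) {η₁ : ℝ} {φ : ℝ × ℝ × ℝ → Base g}
    (hφs : ContMDiff 𝓘(ℝ, ℝ × ℝ × ℝ) (𝓡∂ 4) ∞ φ)
    (hφp : ∀ u r σ, σ ∈ Icc (-η₁) η₁ → φ (u, r, σ) ∈ page g (d k * Complex.exp ((σ : ℂ) * Complex.I)))
    {p : ℝ × ℝ × ℝ} (hσ : p.2.2 ∈ Ioo (-η₁) η₁) (hoff : φ p ∈ coresComplement h)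
    (hy : G₀ (bX.incl (seamLiftChart bX Ψ G₀ D φ p)) ∈ range (beltMap D k).toFun) :
    ContMDiffAt 𝓘(ℝ, ℝ × ℝ × ℝ) 𝓘(ℝ, EuclideanSpace ℝ (Fin 2)) ∞ (fun p' => (transit bX Ψ G₀ D k φ p').2) p :=
  contMDiffAt_snd.comp p (contMDiffAt_transit bX Ψ G₀ D d k hd hφs hφp hσ hoff hy)

/-- The fibre component `p ↦ (χ̂ p).2 ∈ ℝ²` of the transit is `C^∞` (flat form). [folklore] -/
theorem contDiffAt_transit_snd (hd : ‖d k‖ = 1) {η₁ : ℝ} {φ : ℝ × ℝ × ℝ → Base g}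
    (hφs : ContMDiff 𝓘(ℝ, ℝ × ℝ × ℝ) (𝓡∂ 4) ∞ φ)
    (hφp : ∀ u r σ, σ ∈ Icc (-η₁) η₁ → φ (u, r, σ) ∈ page g (d k * Complex.exp ((σ : ℂ) * Complex.I)))
    {p : ℝ × ℝ × ℝ} (hσ : p.2.2 ∈ Ioo (-η₁) η₁) (hoff : φ p ∈ coresComplement h)
    (hy : G₀ (bX.incl (seamLiftChart bX Ψ G₀ D φ p)) ∈ range (beltMap D k).toFun) :
    ContDiffAt ℝ ∞ (fun p' => (transit bX Ψ G₀ D k φ p').2) p :=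
  contMDiffAt_iff_contDiffAt.1 (contMDiffAt_transit_snd bX Ψ G₀ D d k hd hφs hφp hσ hoff hy)

/-- The angle component `p ↦ ((χ̂ p).1 : ℝ²)` of the transit, as a point of the plane, is `C^∞` (flat form).
[folklore] -/
theorem contDiffAt_transit_fst_coe (hd : ‖d k‖ = 1) {η₁ : ℝ} {φ : ℝ × ℝ × ℝ → Base g}
    (hφs : ContMDiff 𝓘(ℝ, ℝ × ℝ × ℝ) (𝓡∂ 4) ∞ φ)
    (hφp : ∀ u r σ, σ ∈ Icc (-η₁) η₁ → φ (u, r, σ) ∈ page g (d k * Complex.exp ((σ : ℂ) * Complex.I)))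
    {p : ℝ × ℝ × ℝ} (hσ : p.2.2 ∈ Ioo (-η₁) η₁) (hoff : φ p ∈ coresComplement h)
    (hy : G₀ (bX.incl (seamLiftChart bX Ψ G₀ D φ p)) ∈ range (beltMap D k).toFun) :
    ContDiffAt ℝ ∞ (fun p' => ((transit bX Ψ G₀ D k φ p').1 : EuclideanSpace ℝ (Fin 2))) p := by
  haveI := Fact.mk (@finrank_euclideanSpace_fin ℝ _ 2)
  have h1 : ContMDiffAt 𝓘(ℝ, ℝ × ℝ × ℝ) (𝓡 1) ∞ (fun p' => (transit bX Ψ G₀ D k φ p').1) p :=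
    contMDiffAt_fst.comp p (contMDiffAt_transit bX Ψ G₀ D d k hd hφs hφp hσ hoff hy)
  have h2 := (contMDiff_coe_sphere (E := EuclideanSpace ℝ (Fin 2)) (n := 1) (m := ∞)).contMDiffAt.comp p h1
  exact contMDiffAt_iff_contDiffAt.1 h2

/-! ## §2 The flat transit is an immersion -/

/-- **The seam lift stays in the belt region near a point where it is in the belt region** (continuity of `Λ₀`,
openness of the belt region). [folklore] -/
theorem eventually_mem_beltRegion (hd : ‖d k‖ = 1) {η₁ : ℝ} {φ : ℝ × ℝ × ℝ → Base g}
    (hφs : ContMDiff 𝓘(ℝ, ℝ × ℝ × ℝ) (𝓡∂ 4) ∞ φ)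
    (hφp : ∀ u r σ, σ ∈ Icc (-η₁) η₁ → φ (u, r, σ) ∈ page g (d k * Complex.exp ((σ : ℂ) * Complex.I)))
    {p : ℝ × ℝ × ℝ} (hσ : p.2.2 ∈ Ioo (-η₁) η₁) (hoff : φ p ∈ coresComplement h)
    (hy : G₀ (bX.incl (seamLiftChart bX Ψ G₀ D φ p)) ∈ range (beltMap D k).toFun) :
    ∀ᶠ p' in 𝓝 p, G₀ (bX.incl (seamLiftChart bX Ψ G₀ D φ p')) ∈ range (beltMap D k).toFun :=
  (contMDiffAt_seamLiftChart bX Ψ G₀ D hd hφs hφp hσ hoff).continuousAt.preimage_mem_nhds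
    ((isOpen_beltRegion bX G₀ D k).mem_nhds hy)

/-- **IMMERSION (flat form)**: for a global section `ang` of `u ↦ e^{2πiu}` that is smooth at `(χ̂ p).1`, the flat
transit `F p' := (ang (χ̂ p').1, (χ̂ p').2)` satisfies `B ∘ F = Λ₀` near `p`, so its differential at `p` is injective
(H4-8: `Λ₀` is an immersion where `φ` is oriented). [cite: LeeSmoothManifolds2013, Thm. 4.25] -/
theorem injective_fderiv_flatTransit (hd : ‖d k‖ = 1) {η₁ : ℝ} {φ : ℝ × ℝ × ℝ → Base g}
    (hφs : ContMDiff 𝓘(ℝ, ℝ × ℝ × ℝ) (𝓡∂ 4) ∞ φ)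
    (hφp : ∀ u r σ, σ ∈ Icc (-η₁) η₁ → φ (u, r, σ) ∈ page g (d k * Complex.exp ((σ : ℂ) * Complex.I)))
    {p : ℝ × ℝ × ℝ} (hσ : p.2.2 ∈ Ioo (-η₁) η₁) (hoff : φ p ∈ coresComplement h)
    (hy : G₀ (bX.incl (seamLiftChart bX Ψ G₀ D φ p)) ∈ range (beltMap D k).toFun)
    (hφo : 0 < inner ℝ (deriv (fun r' => (φ (p.1, r', p.2.2)).1) p.2.1)
      (cplxJ (deriv (fun u' => (φ (u', p.2.1, p.2.2)).1) p.1)))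
    {ang : Metric.sphere (0 : EuclideanSpace ℝ (Fin 2)) 1 → ℝ} (hsec : ∀ θ, circlePt (ang θ) = θ)
    (hang : ContMDiffAt (𝓡 1) 𝓘(ℝ, ℝ) ∞ ang (transit bX Ψ G₀ D k φ p).1) :
    Injective (fderiv ℝ (fun p' : ℝ × ℝ × ℝ =>
      ((ang (transit bX Ψ G₀ D k φ p').1, (transit bX Ψ G₀ D k φ p').2) : ℝ × EuclideanSpace ℝ (Fin 2))) p) := by
  set F : ℝ × ℝ × ℝ → ℝ × EuclideanSpace ℝ (Fin 2) := fun p' =>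
    (ang (transit bX Ψ G₀ D k φ p').1, (transit bX Ψ G₀ D k φ p').2) with hF
  have hχ := contMDiffAt_transit bX Ψ G₀ D d k hd hφs hφp hσ hoff hy
  have hFs : ContMDiffAt 𝓘(ℝ, ℝ × ℝ × ℝ) 𝓘(ℝ, ℝ × EuclideanSpace ℝ (Fin 2)) ∞ F p :=
    (hang.comp p (contMDiffAt_fst.comp p hχ)).prodMk_space (contMDiffAt_snd.comp p hχ)
  have hFd : MDifferentiableAt 𝓘(ℝ, ℝ × ℝ × ℝ) 𝓘(ℝ, ℝ × EuclideanSpace ℝ (Fin 2)) F p := hFs.mdifferentiableAt (by simp)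
  -- `B` is smooth at `F p` (fibre coordinate of norm `< 1`)
  have hmem : F p ∈ (univ : Set ℝ) ×ˢ ball (0 : EuclideanSpace ℝ (Fin 2)) 1 :=
    ⟨mem_univ _, mem_ball_zero_iff.2 (norm_transit_snd_lt_one bX Ψ G₀ D k hy)⟩
  have hBd : MDifferentiableAt 𝓘(ℝ, ℝ × EuclideanSpace ℝ (Fin 2)) (𝓡 3) (beltChartFlat bX G₀ D k) (F p) :=
    ((contMDiffOn_beltChart bX G₀ D k).contMDiffAt ((isOpen_univ.prod isOpen_ball).mem_nhds hmem)).mdifferentiableAt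
      (by simp)
  -- `B ∘ F = Λ₀` near `p`
  have hev : (beltChartFlat bX G₀ D k ∘ F) =ᶠ[𝓝 p] seamLiftChart bX Ψ G₀ D φ := by
    filter_upwards [eventually_mem_beltRegion bX Ψ G₀ D d k hd hφs hφp hσ hoff hy] with p' hp'
    exact beltChartFlat_transit bX Ψ G₀ D k hp' (hsec _)
  have hcomp := mfderiv_comp p hBd hFd
  rw [hev.mfderiv_eq] at hcomp
  -- `Λ₀` is an immersion at `p`
  have hinjΛ : Injective (mfderiv 𝓘(ℝ, ℝ × ℝ × ℝ) (𝓡 3) (seamLiftChart bX Ψ G₀ D φ) p) :=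
    injective_mfderiv_seamLiftChart bX Ψ G₀ D hd hφs hφp hσ hoff hφo
  rw [hcomp] at hinjΛ
  have hinjF : Injective (mfderiv 𝓘(ℝ, ℝ × ℝ × ℝ) 𝓘(ℝ, ℝ × EuclideanSpace ℝ (Fin 2)) F p) :=
    Injective.of_comp hinjΛ
  rwa [mfderiv_eq_fderiv] at hinjF

end Smooth

/-! ## §3 The registered package -/

section Package

/-- **Sub-goal `helper_beltGlue_transitSmooth` of stub `stub_M2geo`** (N1 ▸ `node_N1_move` ▸ (d) N1-mono, geometric
dictionary of piece (d5), part 2; wave 8, lead c5).  THE TRANSIT IS A SMOOTH IMMERSION IN FLAT FORM: for the input chart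
family `φ` of (d) (smooth, level `σ ⊂ page (d k e^{iσ})` for `|σ| ≤ η₁`, oriented at every level), at every box point
`p = (u', r', σ)` (`|r'| < 1`, `|σ| < η₁`) off the cores whose seam lift lies in the belt region of handle `k`: `χ̂` is `C^∞`
at `p`, its flat components `(χ̂ ·).2` and `((χ̂ ·).1 : ℝ²)` are `C^∞` at `p`, and for every global section `ang` of
`e^{2πi·}` smooth at `(χ̂ p).1` the flat transit `(ang (χ̂ ·).1, (χ̂ ·).2)` has injective differential at `p`.
[cite: LeeSmoothManifolds2013, Thm. 4.25] -/
theorem helper_beltGlue_transitSmooth : ∀ (g n : ℕ) [Nonempty (Literature.Topology.FourManifolds.LefschetzBase.bBase g).carrier] (h : Fin n → Literature.Topology.FourManifolds.HandleAttachingMap 3 2 (Literature.Topology.FourManifolds.LefschetzBase.Base g)) (X₀ : Type) [TopologicalSpace X₀] [ChartedSpace (EuclideanHalfSpace 4) X₀] (bX : Literature.Topology.FourManifolds.BoundaryData (𝓡∂ 4) X₀ (𝓡 3)) (Ψ : bX.carrier ≃ₘ⟮𝓡 3, 𝓡 3⟯ (Literature.Topology.FourManifolds.LefschetzBase.bBase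 g).carrier) (X : Type) [TopologicalSpace X] [ChartedSpace (EuclideanHalfSpace 4) X] [IsManifold (𝓡∂ 4) ∞ X] [Nonempty (Literature.Topology.FourManifolds.BoundaryManifold.boundaryData 3 X).carrier] (G₀ : X₀ ≃ₘ⟮𝓡∂ 4, 𝓡∂ 4⟯ X) (D : Literature.Topology.FourManifolds.HandleAttachingMap.MultiAttachmentData h (𝓡∂ 4) X) (d : Fin n → ℂ) (k : Fin n) (η₁ : ℝ) (φ : ℝ × ℝ × ℝ → Literature.Topology.FourManifolds.LefschetzBase.Base g), ‖d k‖ = 1 → ContMDiff 𝓘(ℝ, ℝ × ℝ × ℝ) (𝓡∂ 4) ∞ φ → (∀ u r σ, σ ∈ Set.Icc (-η₁) η₁ → φ (u, r, σ) ∈ Literature.Topology.FourManifolds.LefschetzBase.page g (d k * Complex.exp ((σ : ℂ) * Complex.I))) → (∀ u r σ, r ∈ Set.Ioo (-1 : ℝ) 1 → σ ∈ Set.Icc (-η₁) η₁ → 0 < inner ℝ (deriv (fun r' => (φ (u, r', σ)).1) r) (Literature.Topology.FourManifolds.LefschetzBase.cplxJ (deriv (fun u' => (φ (u', r, σ)).1)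 u))) → ∀ (u' r' σ : ℝ), r' ∈ Set.Ioo (-1 : ℝ) 1 → σ ∈ Set.Ioo (-η₁) η₁ → φ (u', r', σ) ∈ Literature.Topology.FourManifolds.HandleAttachingMap.coresComplement h → G₀ (bX.incl (Summit.SmoothPoincare4.SmoothPoincare4.Theorems.AcyclicBisectionExists.ModpBraidOrbits.seamLiftChart bX Ψ G₀ D φ (u', r', σ))) ∈ Set.range (Summit.SmoothPoincare4.SmoothPoincare4.Theorems.AcyclicBisectionExists.ModpBraidOrbits.beltMap D k).toFun → ContMDiffAt 𝓘(ℝ, ℝ × ℝ × ℝ) ((𝓡 1).prod 𝓘(ℝ, EuclideanSpace ℝ (Fin 2))) ∞ (Summit.SmoothPoincare4.SmoothPoincare4.Theorems.AcyclicBisectionExists.ModpBraidOrbits.transit bX Ψ G₀ D k φ) (u', r', σ) ∧ ContDiffAt ℝ ∞ (fun p' : ℝ × ℝ × ℝ => (Summit.SmoothPoincare4.SmoothPoincare4.Theorems.AcyclicBisectionExists.ModpBraidOrbits.transit bX Ψ G₀ D k φ p').2) (u', r', σ) ∧ ContDiffAt ℝ ∞ (fun p' : ℝ × ℝ × ℝ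 => ((Summit.SmoothPoincare4.SmoothPoincare4.Theorems.AcyclicBisectionExists.ModpBraidOrbits.transit bX Ψ G₀ D k φ p').1 : EuclideanSpace ℝ (Fin 2))) (u', r', σ) ∧ (∀ ang : Metric.sphere (0 : EuclideanSpace ℝ (Fin 2)) 1 → ℝ, (∀ θ, Literature.Topology.FourManifolds.circlePt (ang θ) = θ) → ContMDiffAt (𝓡 1) 𝓘(ℝ, ℝ) ∞ ang (Summit.SmoothPoincare4.SmoothPoincare4.Theorems.AcyclicBisectionExists.ModpBraidOrbits.transit bX Ψ G₀ D k φ (u', r', σ)).1 → Function.Injective (fderiv ℝ (fun p' : ℝ × ℝ × ℝ => ((ang (Summit.SmoothPoincare4.SmoothPoincare4.Theorems.AcyclicBisectionExists.ModpBraidOrbits.transit bX Ψ G₀ D k φ p').1, (Summit.SmoothPoincare4.SmoothPoincare4.Theorems.AcyclicBisectionExists.ModpBraidOrbits.transit bX Ψ G₀ D k φ p').2) : ℝ × EuclideanSpace ℝ (Fin 2))) (u', r', σ))) := by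
  intro g n _ h X₀ _ _ bX Ψ X _ _ _ _ G₀ D d k η₁ φ hd hφs hφp hφo u' r' σ hr hσ hoff hy
  have hσ' : ((u', r', σ) : ℝ × ℝ × ℝ).2.2 ∈ Ioo (-η₁) η₁ := hσ
  have hσc : ((u', r', σ) : ℝ × ℝ × ℝ).2.2 ∈ Icc (-η₁) η₁ := ⟨hσ.1.le, hσ.2.le⟩
  exact ⟨contMDiffAt_transit bX Ψ G₀ D d k hd hφs hφp hσ' hoff hy,
    contDiffAt_transit_snd bX Ψ G₀ D d k hd hφs hφp hσ' hoff hy,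
    contDiffAt_transit_fst_coe bX Ψ G₀ D d k hd hφs hφp hσ' hoff hy, fun ang hsec hang =>
    injective_fderiv_flatTransit bX Ψ G₀ D d k hd hφs hφp hσ' hoff hy (hφo u' r' σ hr hσc) hsec hang⟩

end Package

end Summit.SmoothPoincare4.SmoothPoincare4.Theorems.AcyclicBisectionExists.ModpBraidOrbits

end
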